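import Mathlib
import Summits.Ventures.HodgeRepro2.Tier7.Line3.CoverCountGlobal

/-!
# Tier7/Line3/NumeratorExponent — the box exponents `e₁ = val_w κ`, `e₂ = val_w (κ − 1)` are at most the multiplicities of
the numerator ideals, and the split product with constants in numerator-ideal form (`he₁ / he₂` DISCHARGED)

Filer: t7-L1-p3 (gen 9, prover-pub-hodge-repro2-t7-L1-p3-g9-0), self-selected SUPPORT row (TARGET line with the 10-min
window; crit-2's record STATUS l. 16270 (5)). Lane: Line 3 SUPPORT, [M]-level; NOT a line, NOT a device; touches neither
(a′) nor (b′). x1's numerator-ideal rows (NumeratorNorm p710707, NumeratorNormDefinite p711354, NumeratorIdealSize p714124)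
are CONSUMED BY SHAPE — `I γ = (aNum)`, `J γ = (bNum)` with `(aNum : K) = m · κ(γ)`, `(bNum : K) = m · (κ(γ) − 1)`,
`m, aNum, bNum ∈ 𝓞 K` — nothing of theirs imported or restated.

WHAT IT SUPPLIES. CoverCountGlobal's `exists_splitFactor_le_of_compact_supports_global` still DISPLAYS the (h⁵⁗)
dictionary inequality `he₁ : e₁ ≤ mult_w (I γ)`, `he₂ : e₂ ≤ mult_w (J γ)` at every place (`e₁ = ord (v det) − ord (v a) −
ord (v d)`, `e₂ = ord (v det) − ord (v b) − ord (v c)`, x1's exponents of `ad/det`, `bc/det`). For the NUMERATOR IDEALS of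
`κ = ad/det` and `κ − 1 = bc/det` it is a THEOREM:
* J1 `ordK w x hx := ord (w.valuation K x)` (x1's `ord = toAdd ∘ unzero`, the negative of the usual additive valuation);
  `ordK_mul`, `ordK_div` (additivity); `ordK_algebraMap`: for an integer `r ≠ 0`, `ordK w r = −mult_w ((r))` — Mathlib's
  `intValuation_eq_exp_neg_multiplicity` through `valuation_of_algebraMap`; hence `ordK w r ≤ 0`;
* J2 `exponent_le_multiplicity_num`: `aNum = m · κ` ⇒ `e₁ = ordK det − ordK a − ordK d = −ordK κ = ordK m − ordK aNum =
  ordK m + mult_w ((aNum)) ≤ mult_w ((aNum))`; `exponent_le_multiplicity_num'`: the same for `bNum = m · (κ − 1)` with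
  `κ − 1 = bc/det`; `ord_valued_algebraMap`: the exponent read at the completion (`Valued.v` of the image) is `ordK`;
* J3 `exists_splitFactor_le_of_compact_supports_num`: CoverCountGlobal's theorem with `I γ := (aNum γ)`, `J γ := (bNum γ)`
  — `he₁ / he₂` DISCHARGED at every place, `hI / hJ` from `m ≠ 0` and `κ ∉ {0, 1}` (automatic from the four non-zero
  entries): for compact supports `U w` with `U w = GL₂(O_w)` off a finite set, global entries of `γ` (non-zero, `det ≠ 0`)
  and the numerator data `(m, aNum, bNum)` with their two defining equations, ONE constant `C` bounds `splitFactor b γ`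
  by `C · (N((aNum γ)) · N((bNum γ)))^ε` for all `γ`.

WHAT STAYS IN WORDS (the dictionary, (a′)) — the residue of the split-place table after this row: `U_w = supp f_w` is a
compact subset of `GL₂(F_w)` with `U_w = GL₂(O_w)` off a finite set (`f_w = 1_{K_w}` off `S`); the real `γ` ARE global with
the adapted-basis entries non-zero (`κ(γ) ∉ {0, 1}`); `b w γ` IS this count; the numerator data `(m, aNum, bNum)` of the
real `κ(γ)` (x1's `I γ`, `J γ` — the `size γ = N(I γ) N(J γ)` of the product row); the place datum. Nothing here is about
(N), (P), the real `X`, or HC_CM. §8(d): NO. Blind lane: Mathlib + the HodgeRepro2 prefix; no sorry;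
axioms ⊆ {propext, Classical.choice, Quot.sound}.
-/

namespace Summit.Ventures.HodgeRepro2.Tier7.Line3.NumeratorExponent

open Matrix WithZero Multiplicative IsDedekindDomain IsDedekindDomain.HeightOneSpectrum NumberField Function
  Summit.Ventures.HodgeRepro2.Tier7.Line3.SplitOrbitBox
  Summit.Ventures.HodgeRepro2.Tier7.Line3.SplitFactorConstants
  Summit.Ventures.HodgeRepro2.Tier7.Line3.SplitFactorProduct
  Summit.Ventures.HodgeRepro2.Tier7.Line3.CosetEntryBounds
  Summit.Ventures.HodgeRepro2.Tier7.Line3.DoubleCosetCover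
  Summit.Ventures.HodgeRepro2.Tier7.Line3.CoverCountLink
  Summit.Ventures.HodgeRepro2.Tier7.Line3.CoverCountGlobal
open scoped NumberField

/-! ## J1. The additive order of a global element at a finite place, in x1's convention (`ord = −val_w`) -/

section Ord

/-- `ord` depends only on the value. -/
theorem ord_congr {X Y : WithZero (Multiplicative ℤ)} (hX : X ≠ 0) (hY : Y ≠ 0) (h : X = Y) :
    ord hX = ord hY := by
  subst h; rfl

/-- `ord (exp (−n)) = −n`. -/
theorem ord_exp_neg (n : ℤ) :
    ord (show (WithZero.exp (-n) : WithZero (Multiplicative ℤ)) ≠ 0 from WithZero.coe_ne_zero) = -n :=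
  ord_coe_ofAdd (-n)

variable {K : Type*} [Field K] [NumberField K]

/-- **the order of a non-zero global element at `w`** (SplitOrbitBox's `ord = toAdd ∘ unzero` of the `w`-adic value;
the NEGATIVE of the usual additive valuation: `ordK w ϖ = −1` for a uniformiser). -/
noncomputable def ordK (w : HeightOneSpectrum (𝓞 K)) (x : K) (hx : x ≠ 0) : ℤ :=
  ord ((Valuation.ne_zero_iff (w.valuation K)).2 hx)

/-- `ordK` is additive: `ordK (x · y) = ordK x + ordK y`. -/
theorem ordK_mul (w : HeightOneSpectrum (𝓞 K)) {x y : K} (hx : x ≠ 0) (hy : y ≠ 0) :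
    ordK w (x * y) (mul_ne_zero hx hy) = ordK w x hx + ordK w y hy := by
  unfold ordK
  rw [← ord_mul ((Valuation.ne_zero_iff (w.valuation K)).2 hx) ((Valuation.ne_zero_iff (w.valuation K)).2 hy)]
  exact ord_congr _ _ (Valuation.map_mul _ _ _)

/-- `ordK (x / y) = ordK x − ordK y`. -/
theorem ordK_div (w : HeightOneSpectrum (𝓞 K)) {x y : K} (hx : x ≠ 0) (hy : y ≠ 0) :
    ordK w (x / y) (div_ne_zero hx hy) = ordK w x hx - ordK w y hy := by
  unfold ordK
  rw [← ord_div ((Valuation.ne_zero_iff (w.valuation K)).2 hx) ((Valuation.ne_zero_iff (w.valuation K)).2 hy)]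
  exact ord_congr _ _ (Valuation.map_div _ _ _)

/-- **the order of an integer is minus the multiplicity of `w` in the ideal it generates**
(Mathlib's `intValuation_eq_exp_neg_multiplicity` through `valuation_of_algebraMap`). -/
theorem ordK_algebraMap (w : HeightOneSpectrum (𝓞 K)) (r : 𝓞 K) (hr : r ≠ 0) :
    ordK w (algebraMap (𝓞 K) K r) (RingOfIntegers.coe_ne_zero_iff.2 hr) = -(multiplicity w.asIdeal (Ideal.span {r}) : ℤ) := by
  unfold ordK
  have e : w.valuation K (algebraMap (𝓞 K) K r) =
      WithZero.exp (-(multiplicity w.asIdeal (Ideal.span {r}) : ℤ)) := by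
    rw [valuation_of_algebraMap, w.intValuation_eq_exp_neg_multiplicity hr]
  rw [ord_congr _ WithZero.coe_ne_zero e]
  exact ord_exp_neg _

/-- an integer has order `≤ 0` at every finite place. -/
theorem ordK_algebraMap_le_zero (w : HeightOneSpectrum (𝓞 K)) (r : 𝓞 K) (hr : r ≠ 0) :
    ordK w (algebraMap (𝓞 K) K r) (RingOfIntegers.coe_ne_zero_iff.2 hr) ≤ 0 := by
  rw [ordK_algebraMap w r hr]
  exact neg_nonpos.2 (Int.natCast_nonneg _)

end Ord

/-! ## J2. The box exponents `e₁ = val_w κ`, `e₂ = val_w (κ − 1)` are at most the multiplicities of the numerator ideals -/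

section Exponent

variable {K : Type*} [Field K] [NumberField K]

/-- **the exponent of record is `−ordK κ`** (plan-3 l. 16387 (1)): `e₁ = ordK det − ordK a − ordK d = −ordK (a d / det)`. -/
theorem exponent_eq_neg_ordK_kappa (w : HeightOneSpectrum (𝓞 K)) (a b c d : K)
    (ha : a ≠ 0) (hd : d ≠ 0) (hdet : a * d - b * c ≠ 0) :
    ordK w (a * d - b * c) hdet - ordK w a ha - ordK w d hd =
      -ordK w (a * d / (a * d - b * c)) (div_ne_zero (mul_ne_zero ha hd) hdet) := by
  rw [ordK_div w (mul_ne_zero ha hd) hdet, ordK_mul w ha hd]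
  ring

/-- **`e₂ = −ordK (κ − 1)`**: `κ − 1 = b c / det`, so `ordK det − ordK b − ordK c = −ordK (κ − 1)`. -/
theorem exponent_eq_neg_ordK_kappa_sub_one (w : HeightOneSpectrum (𝓞 K)) (a b c d : K)
    (hb : b ≠ 0) (hc : c ≠ 0) (hdet : a * d - b * c ≠ 0) :
    ordK w (a * d - b * c) hdet - ordK w b hb - ordK w c hc =
      -ordK w (a * d / (a * d - b * c) - 1) (by
        rw [show a * d / (a * d - b * c) - 1 = b * c / (a * d - b * c) by field_simp; ring]
        exact div_ne_zero (mul_ne_zero hb hc) hdet) := by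
  have hκ1 : a * d / (a * d - b * c) - 1 = b * c / (a * d - b * c) := by
    field_simp
    ring
  have hbc : b * c / (a * d - b * c) ≠ 0 := div_ne_zero (mul_ne_zero hb hc) hdet
  have e : ordK w (a * d / (a * d - b * c) - 1) (by
      rw [show a * d / (a * d - b * c) - 1 = b * c / (a * d - b * c) by field_simp; ring]
      exact div_ne_zero (mul_ne_zero hb hc) hdet) = ordK w (b * c / (a * d - b * c)) hbc := by
    unfold ordK
    exact ord_congr _ _ (by rw [hκ1])
  rw [e, ordK_div w (mul_ne_zero hb hc) hdet, ordK_mul w hb hc]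
  ring

omit [NumberField K] in
/-- `aNum ≠ 0` from `m ≠ 0` and `κ ≠ 0` (`a d ≠ 0`) — derived, never a binder (plan-3 l. 16387 (3)). -/
theorem aNum_ne_zero (a b c d : K) (ha : a ≠ 0) (hd : d ≠ 0) (hdet : a * d - b * c ≠ 0)
    (m aNum : 𝓞 K) (hm : m ≠ 0) (haNum : (aNum : K) = (m : K) * (a * d / (a * d - b * c))) : aNum ≠ 0 := by
  intro h
  have : (aNum : K) = 0 := by rw [h]; exact map_zero _
  rw [haNum] at this
  exact mul_ne_zero (RingOfIntegers.coe_ne_zero_iff.2 hm) (div_ne_zero (mul_ne_zero ha hd) hdet) this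

omit [NumberField K] in
/-- `bNum ≠ 0` from `m ≠ 0` and `κ ≠ 1` (`b c ≠ 0`) — derived, never a binder. -/
theorem bNum_ne_zero (a b c d : K) (hb : b ≠ 0) (hc : c ≠ 0) (hdet : a * d - b * c ≠ 0)
    (m bNum : 𝓞 K) (hm : m ≠ 0) (hbNum : (bNum : K) = (m : K) * (a * d / (a * d - b * c) - 1)) : bNum ≠ 0 := by
  intro h
  have : (bNum : K) = 0 := by rw [h]; exact map_zero _
  have hκ1 : a * d / (a * d - b * c) - 1 = b * c / (a * d - b * c) := by
    field_simp
    ring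
  rw [hbNum, hκ1] at this
  exact mul_ne_zero (RingOfIntegers.coe_ne_zero_iff.2 hm) (div_ne_zero (mul_ne_zero hb hc) hdet) this

/-- **`e₁ ≤ mult_w (I)`** for the numerator ideal `I = (aNum)` of `κ = a d / det`: if `aNum = m · κ` with `m, aNum ∈ 𝓞 K`,
then `e₁ = ordK det − ordK a − ordK d = −ordK κ = ordK m − ordK aNum = ordK m + mult_w (aNum) ≤ mult_w (aNum)`. -/
theorem exponent_le_multiplicity_num (w : HeightOneSpectrum (𝓞 K)) (a b c d : K)
    (ha : a ≠ 0) (_hb : b ≠ 0) (_hc : c ≠ 0) (hd : d ≠ 0) (hdet : a * d - b * c ≠ 0)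
    (m aNum : 𝓞 K) (hm : m ≠ 0) (haNum : (aNum : K) = (m : K) * (a * d / (a * d - b * c))) :
    ordK w (a * d - b * c) hdet - ordK w a ha - ordK w d hd ≤ (multiplicity w.asIdeal (Ideal.span {aNum}) : ℤ) := by
  have hκ : a * d / (a * d - b * c) ≠ 0 := div_ne_zero (mul_ne_zero ha hd) hdet
  have hm' : (m : K) ≠ 0 := RingOfIntegers.coe_ne_zero_iff.2 hm
  have haK : (aNum : K) ≠ 0 := by rw [haNum]; exact mul_ne_zero hm' hκ
  have ha0 : aNum ≠ 0 := fun h => haK (by rw [h]; exact map_zero _)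
  have h1 : ordK w (aNum : K) haK = ordK w (m : K) hm' + ordK w (a * d / (a * d - b * c)) hκ := by
    rw [← ordK_mul w hm' hκ]
    exact ord_congr _ _ (by rw [haNum])
  have h2 : ordK w (a * d / (a * d - b * c)) hκ = ordK w a ha + ordK w d hd - ordK w (a * d - b * c) hdet := by
    rw [ordK_div w (mul_ne_zero ha hd) hdet, ordK_mul w ha hd]
  have h3 : ordK w (aNum : K) haK = -(multiplicity w.asIdeal (Ideal.span {aNum}) : ℤ) := ordK_algebraMap w aNum ha0
  have h4 : ordK w (m : K) hm' ≤ 0 := ordK_algebraMap_le_zero w m hm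
  linarith

/-- **`e₂ ≤ mult_w (J)`** for the numerator ideal `J = (bNum)` of `κ − 1 = b c / det`: if `bNum = m · (κ − 1)`, then
`e₂ = ordK det − ordK b − ordK c = −ordK (κ − 1) ≤ mult_w (bNum)`. -/
theorem exponent_le_multiplicity_num' (w : HeightOneSpectrum (𝓞 K)) (a b c d : K)
    (_ha : a ≠ 0) (hb : b ≠ 0) (hc : c ≠ 0) (_hd : d ≠ 0) (hdet : a * d - b * c ≠ 0)
    (m bNum : 𝓞 K) (hm : m ≠ 0) (hbNum : (bNum : K) = (m : K) * (a * d / (a * d - b * c) - 1)) :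
    ordK w (a * d - b * c) hdet - ordK w b hb - ordK w c hc ≤ (multiplicity w.asIdeal (Ideal.span {bNum}) : ℤ) := by
  have hκ1 : a * d / (a * d - b * c) - 1 = b * c / (a * d - b * c) := by
    field_simp
    ring
  have hbc : b * c / (a * d - b * c) ≠ 0 := div_ne_zero (mul_ne_zero hb hc) hdet
  have hbNum' : (bNum : K) = (m : K) * (b * c / (a * d - b * c)) := by rw [hbNum, hκ1]
  have hm' : (m : K) ≠ 0 := RingOfIntegers.coe_ne_zero_iff.2 hm
  have hbK : (bNum : K) ≠ 0 := by rw [hbNum']; exact mul_ne_zero hm' hbc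
  have hb0 : bNum ≠ 0 := fun h => hbK (by rw [h]; exact map_zero _)
  have h1 : ordK w (bNum : K) hbK = ordK w (m : K) hm' + ordK w (b * c / (a * d - b * c)) hbc := by
    rw [← ordK_mul w hm' hbc]
    exact ord_congr _ _ (by rw [hbNum'])
  have h2 : ordK w (b * c / (a * d - b * c)) hbc = ordK w b hb + ordK w c hc - ordK w (a * d - b * c) hdet := by
    rw [ordK_div w (mul_ne_zero hb hc) hdet, ordK_mul w hb hc]
  have h3 : ordK w (bNum : K) hbK = -(multiplicity w.asIdeal (Ideal.span {bNum}) : ℤ) := ordK_algebraMap w bNum hb0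
  have h4 : ordK w (m : K) hm' ≤ 0 := ordK_algebraMap_le_zero w m hm
  linarith

/-- the order read at the completion (`Valued.v` of the image) is `ordK`. -/
theorem ord_valued_algebraMap (w : HeightOneSpectrum (𝓞 K)) (x : K) (hx : x ≠ 0)
    (h : (Valued.v (algebraMap K (w.adicCompletion K) x) : WithZero (Multiplicative ℤ)) ≠ 0) :
    ord h = ordK w x hx :=
  ord_congr _ _ (valued_algebraMap w x)

end Exponent

/-! ## J3. The split product with constants for global `γ` and the numerator ideals: `he₁ / he₂` DISCHARGED -/

section Composite

variable {K : Type*} [Field K] [NumberField K]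

/-- **THE SPLIT PRODUCT WITH CONSTANTS, NUMERATOR-IDEAL FORM**: CoverCountGlobal's theorem with `I γ := span {aNum γ}`,
`J γ := span {bNum γ}` — the PRINCIPAL ideals generated by the numerator data of `κ(γ) = a d / det` and `κ(γ) − 1`
(`aNum = m · κ`, `bNum = m · (κ − 1)` with `m, aNum, bNum ∈ 𝓞 K`, `m ≠ 0`; `m` is ANY common denominator, no minimality
displayed — a larger `m` inflates `N(span {aNum})`, so the bound is WEAKER for a worse `m` and `C` does not depend on it;
in a non-PID `span {aNum}` is a principal multiple of the lowest-terms numerator ideal, not that ideal itself — crit-2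
l. 16386 (2), plan-3 l. 16387 (2)) — for the SAME `(m, aNum, bNum)` as x1's NumeratorNorm / NumeratorNormDefinite /
NumeratorIdealSize: `he₁ / he₂` DISCHARGED at every place (`exponent_le_multiplicity_num`), `hI / hJ` from `m ≠ 0` and
`κ ∉ {0, 1}` (`aNum_ne_zero` / `bNum_ne_zero`, automatic from the four non-zero entries). THE ORBIT: `ha hb hc hd hdet`
make `Orb` the all-entries-non-zero orbit (`κ ∉ {0, 1}`, plan-3 l. 16142 (ii)); the degenerate `γ` of the real orbit are
OUTSIDE it (crit-2 l. 16386 (1)). What is displayed: the compact supports `U w` with `U w = GL₂(O_w)` off a finite set,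
the global entries of `γ` (non-zero, `det ≠ 0`, the literal `a d − b c` in both equations) and the numerator data
`(m, aNum, bNum)` with their two defining equations — BINDER-FOR-BINDER x1's NumeratorIdealSize `ha : (a : K) = m * x`,
`hb : (b : K) = m * (x − 1)` at `a := aNum γ`, `b := bNum γ`, `x := κ γ` (x1 l. 16385), so its
`absNorm_span_mul_absNorm_span_le … (aNum γ) (bNum γ) (m γ) haNum hbNum D hD` composes directly with this theorem to bound
`(N((aNum γ)) N((bNum γ)))^ε` by the archimedean size — a consumer's one-liner, not this row. -/
theorem exists_splitFactor_le_of_compact_supports_num {Orb : Type*} {ε : ℝ} (hε : 0 < ε)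
    (U : ∀ w : HeightOneSpectrum (𝓞 K), Set (GL (Fin 2) (w.adicCompletion K))) (hU : ∀ w, IsCompact (U w))
    (hS : {w : HeightOneSpectrum (𝓞 K) | U w ≠ (integralSubgroup
      (Valued.v : Valuation (w.adicCompletion K) (WithZero (Multiplicative ℤ))).integer :
      Set (GL (Fin 2) (w.adicCompletion K)))}.Finite)
    (a b c d : Orb → K)
    (ha : ∀ γ, a γ ≠ 0) (hb : ∀ γ, b γ ≠ 0) (hc : ∀ γ, c γ ≠ 0) (hd : ∀ γ, d γ ≠ 0)
    (hdet : ∀ γ, a γ * d γ - b γ * c γ ≠ 0)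
    (m aNum bNum : Orb → 𝓞 K) (hm : ∀ γ, m γ ≠ 0)
    (haNum : ∀ γ, (aNum γ : K) = (m γ : K) * (a γ * d γ / (a γ * d γ - b γ * c γ)))
    (hbNum : ∀ γ, (bNum γ : K) = (m γ : K) * (a γ * d γ / (a γ * d γ - b γ * c γ) - 1)) :
    ∃ C : ℝ, 0 < C ∧ ∀ γ,
      splitFactor (fun (w : HeightOneSpectrum (𝓞 K)) γ =>
        (valuePair (Valued.v : Valuation (w.adicCompletion K) (WithZero (Multiplicative ℤ))) ''
          sol (algebraMap K (w.adicCompletion K) (a γ)) (algebraMap K (w.adicCompletion K) (b γ))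
            (algebraMap K (w.adicCompletion K) (c γ)) (algebraMap K (w.adicCompletion K) (d γ))
          ((fun x : GL (Fin 2) (w.adicCompletion K) => (x : Matrix (Fin 2) (Fin 2) (w.adicCompletion K))) ''
            U w)).ncard) γ ≤
        C * ((Ideal.absNorm (Ideal.span {aNum γ}) : ℝ) * Ideal.absNorm (Ideal.span {bNum γ})) ^ ε := by
  have hI : ∀ γ, Ideal.span {aNum γ} ≠ ⊥ := fun γ => by
    rw [Ne, Ideal.span_singleton_eq_bot]
    exact aNum_ne_zero (a γ) (b γ) (c γ) (d γ) (ha γ) (hd γ) (hdet γ) (m γ) (aNum γ) (hm γ) (haNum γ)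
  have hJ : ∀ γ, Ideal.span {bNum γ} ≠ ⊥ := fun γ => by
    rw [Ne, Ideal.span_singleton_eq_bot]
    exact bNum_ne_zero (a γ) (b γ) (c γ) (d γ) (hb γ) (hc γ) (hdet γ) (m γ) (bNum γ) (hm γ) (hbNum γ)
  refine exists_splitFactor_le_of_compact_supports_global (fun γ => Ideal.span {aNum γ})
    (fun γ => Ideal.span {bNum γ}) hε hI hJ U hU hS a b c d ha hb hc hd hdet (fun w γ => ?_) (fun w γ => ?_)
  · have hdet' : algebraMap K (w.adicCompletion K) (a γ) * algebraMap K (w.adicCompletion K) (d γ) -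
        algebraMap K (w.adicCompletion K) (b γ) * algebraMap K (w.adicCompletion K) (c γ) =
        algebraMap K (w.adicCompletion K) (a γ * d γ - b γ * c γ) := by
      rw [map_sub, map_mul, map_mul]
    rw [ord_congr _ ((Valuation.ne_zero_iff _).2 ((map_ne_zero _).2 (hdet γ))) (by rw [hdet']),
      ord_valued_algebraMap w _ (hdet γ), ord_valued_algebraMap w _ (ha γ), ord_valued_algebraMap w _ (hd γ)]
    exact exponent_le_multiplicity_num w (a γ) (b γ) (c γ) (d γ) (ha γ) (hb γ) (hc γ) (hd γ) (hdet γ)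
      (m γ) (aNum γ) (hm γ) (haNum γ)
  · have hdet' : algebraMap K (w.adicCompletion K) (a γ) * algebraMap K (w.adicCompletion K) (d γ) -
        algebraMap K (w.adicCompletion K) (b γ) * algebraMap K (w.adicCompletion K) (c γ) =
        algebraMap K (w.adicCompletion K) (a γ * d γ - b γ * c γ) := by
      rw [map_sub, map_mul, map_mul]
    rw [ord_congr _ ((Valuation.ne_zero_iff _).2 ((map_ne_zero _).2 (hdet γ))) (by rw [hdet']),
      ord_valued_algebraMap w _ (hdet γ), ord_valued_algebraMap w _ (hb γ), ord_valued_algebraMap w _ (hc γ)]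
    exact exponent_le_multiplicity_num' w (a γ) (b γ) (c γ) (d γ) (ha γ) (hb γ) (hc γ) (hd γ) (hdet γ)
      (m γ) (bNum γ) (hm γ) (hbNum γ)

end Composite

end Summit.Ventures.HodgeRepro2.Tier7.Line3.NumeratorExponent
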